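import Summits.CriticalPhenomena.PercolationContinuityZ3.Theorems.Transplant.SkelNegBParamsFaceCountsRangeA
import Summits.CriticalPhenomena.PercolationContinuityZ3.Theorems.Transplant.SkelNegBParamsFaceLamA
import HarnessLib

/-!
# N1 params, M3 group G-Z (x-face) — **THE HABITAT-VERSUS-ZONE FLOORS OF AN x-FACE AT THE (ζ′) TUPLE**: the fields `hfR` and `hZfar` of
# `Skelφ.FloorsX2` (SkelPhiFaceNumsXP2 :43–:45) at M3-FLOORS-SIGNATURE §1 with the Λ-ceilings `kA 0 := kF₀A`, `kA 1 := kF₁A` (FaceLamA p320758)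
(p1-g14, 2026-08-22; claim lane INBOX 07:57:35Z; conclusions = p3-g12's pinned `hfR_XA`/`hZfar_XA` with the skeleton's `kAF κ Φ t p D c mk g f` — a `def`
not yet in the tree — written as its literal `fun i => if i = 0 then kF₀A … else kF₁A …` (definitionally equal; the assembly's `⟨…⟩` elaborates through it)).
Slot-generic in `(g, f)`; premise block trimmed; FOUR added hypotheses in served shapes: `hkF0 : kF₀A ≤ 8·u₀A + 1`, `hkF1 : kF₁A ≤ 8·u₁A + 1`
(= `KS.kFA_le` at `g := gT mk gx` under `16·S_F ≤ M_L`), `hs0 : 6·RA′ + 11 ≤ u₀A` (= `(KS.cells_geTA' …).1`), `hkE8 : kE + 8·u₁A + 8 ≤ 5·r₁`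
(= `NegB.hkE_apron_RA … 0`, FaceBandA2, at hp-8's `kE := kFF₂ … (E − 1) 0`).  Arithmetic: `lev ∈ [faceL 0 j − E, faceL 0 j + E]`, `faceL 0 j = 5r₀ + 10u₀(j+1) − 1`,
`E ≤ u₀`, `r₀ = 40·Kq·u₀`, `b0TA 0 = 10·Kq·u₀`.
builds on p205010 (kernel theorem, internal audit signed; external expert review pending) — nothing in this file uses p205010; NOTHING is claimed about the node
`SamePDropOfSkeletonNeg₁` (OPEN); integer arithmetic only.
Lane `prim-bschramm-*`, seat `prim-bschramm-p1` (gen 14); helper file (`--supports stmt-CriticalPhenomena-4575 --as helper`); slot-ledger ζ′ v1.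
* **`hfR_XA`**, **`hZfar_XA`**.
[cite: KozmaNitzan2024, §4 Lemma 12 (pp. 23–25)] [cite: MartineauTassion2017, §4.1]
-/

noncomputable section

open scoped Classical

namespace Summit.CriticalPhenomena.PercolationContinuityZ3.Theorems.Transplant

namespace PlanarSkeletonNeg

namespace NegB

open Literature.Probability.Percolation Literature.Probability.LatticeModels SimpleGraph
open Literature.Probability.Percolation.KozmaNitzan.Cells (oth sgOf sgOf_sign)
open SkelConc (Consts)
open Skelφ.StepI (DataN)
open TwoAxis.Para (modulus)
open Neg

namespace KS

section FloorsZ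

variable (κ : Consts) {V : Type} [DecidableEq V] [Countable V] {G : SimpleGraph V} [G.LocallyFinite] (Φ : PlanarSkeletonNeg G) (t : V)
  (p : unitInterval) (D : DataN V) (c mk g f : ℕ)

/-- **M3 x-face field `hfR`** at the (ζ′) tuple: the habitat `flo = 5r₀ + 10u₀j + 3 − lev ≤ −kF₀A`, `kF₀A ≤ fhi = 25r₀ − 2 − lev`, and transversally
`kF₁A ≤ 5r₁ − 7 − |z 1 − cen x 1|`. [cite: KozmaNitzan2024, §4 Lemma 12 (pp. 23–25)] -/
theorem hfR_XA (x : Site 2) (du : MDir) (hd : du.1 = 0) (j : ℕ) (hj : j < (fcellsA κ Φ t p D g f).K) (z : Site 2) {E : ℕ} {kE : ℤ}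
    (hlev1 : (fcellsA κ Φ t p D g f).faceL 0 j - E ≤ (fcellsA κ Φ t p D g f).lev du x z) (hlev2 : (fcellsA κ Φ t p D g f).lev du x z ≤ (fcellsA κ Φ t p D g f).faceL 0 j + E)
    (hz : |z 1 - (fcellsA κ Φ t p D g f).cen x 1| ≤ kE) (hEu : (E : ℤ) ≤ u₀A κ Φ t p D g f)
    (hkF0 : kF₀A κ Φ t p D c mk g f ≤ 8 * u₀A κ Φ t p D g f + 1) (hkF1 : kF₁A κ Φ t p D c mk g f ≤ 8 * u₁A κ Φ t p D g f + 1)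
    (hs0 : 6 * (RA' κ Φ t p D mk : ℤ) + 11 ≤ u₀A κ Φ t p D g f) (hkE8 : kE + 8 * u₁A κ Φ t p D g f + 8 ≤ 5 * ((fcellsA κ Φ t p D g f).r 1 : ℤ)) :
    (5 * ((fcellsA κ Φ t p D g f).r du.1 : ℤ) + 10 * (fcellsA κ Φ t p D g f).s du.1 * j + 3 - (fcellsA κ Φ t p D g f).lev du x z) ≤ -((fun i : Fin 2 => if i = 0 then kF₀A κ Φ t p D c mk g f else kF₁A κ Φ t p D c mk g f) du.1) ∧ ((fun i : Fin 2 => if i = 0 then kF₀A κ Φ t p D c mk g f else kF₁A κ Φ t p D c mk g f) du.1) ≤ (25 * ((fcellsA κ Φ t p D g f).r du.1 : ℤ) - 2 - (fcellsA κ Φ t p D g f).lev du x z) ∧ ((fun i : Fin 2 => if i = 0 then kF₀A κ Φ t p D c mk g f else kF₁A κ Φ t p D c mk g f) (oth du.1)) ≤ (5 * ((fcellsA κ Φ t p D g f).r (oth du.1) : ℤ) - 4 - (3 : ℤ) - |z (oth du.1) - (fcellsA κ Φ t p D g f).cen x (oth du.1)|) := by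
  rw [hd, show oth (0 : Fin 2) = 1 from rfl]
  simp only [if_true, show ((1 : Fin 2) = 0) = False from propext ⟨fun h => absurd h (by decide), False.elim⟩, if_false]
  obtain ⟨f1, f2⟩ := faceL_bounds κ Φ t p D g f j hj
  have hR0 : (0 : ℤ) ≤ (RA' κ Φ t p D mk : ℤ) := Nat.cast_nonneg _
  have hr : ((fcellsA κ Φ t p D g f).r 0 : ℤ) = 40 * (Neg.Kq κ : ℤ) * u₀A κ Φ t p D g f := (units_eqA κ Φ t p D g f).2.2.1
  have hq : (1 : ℤ) ≤ Neg.Kq κ := by exact_mod_cast Neg.one_le_Kq κ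
  have es : (((fcellsA κ Φ t p D g f).s 0 : ℕ) : ℤ) = u₀A κ Φ t p D g f := rfl
  have hfl : (fcellsA κ Φ t p D g f).faceL 0 j = 5 * ((fcellsA κ Φ t p D g f).r 0 : ℤ) + 10 * u₀A κ Φ t p D g f * ((j : ℤ) + 1) - 1 := by
    unfold PCells2.faceL; rw [es]; push_cast; ring
  rw [es]
  rw [hfl] at hlev1 hlev2
  have hu : 1 ≤ u₀A κ Φ t p D g f := (units_eqA κ Φ t p D g f).2.2.2.2.2.2.1
  have hQu : u₀A κ Φ t p D g f ≤ (Neg.Kq κ : ℤ) * u₀A κ Φ t p D g f := le_mul_of_one_le_left (by linarith) hq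
  have hz' := (abs_nonneg _).trans hz
  refine ⟨by linarith, by linarith, by linarith⟩

/-- **M3 x-face field `hZfar`** at the (ζ′) tuple: `lev + kF₀A + 1 < 20r₀ − b0TA 0` (`lev ≤ 15r₀ − 1 + E`, `kF₀A ≤ 8u₀ + 1`, `b0TA 0 = 10·Kq·u₀`,
`5r₀ = 200·Kq·u₀`). [cite: KozmaNitzan2024, §4 Lemma 12 (pp. 23–25)] -/
theorem hZfar_XA (x : Site 2) (du : MDir) (hd : du.1 = 0) (j : ℕ) (hj : j < (fcellsA κ Φ t p D g f).K) (z : Site 2) {E : ℕ}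
    (hlev2 : (fcellsA κ Φ t p D g f).lev du x z ≤ (fcellsA κ Φ t p D g f).faceL 0 j + E) (hEu : (E : ℤ) ≤ u₀A κ Φ t p D g f)
    (hkF0 : kF₀A κ Φ t p D c mk g f ≤ 8 * u₀A κ Φ t p D g f + 1) :
    (fcellsA κ Φ t p D g f).lev du x z + ((fun i : Fin 2 => if i = 0 then kF₀A κ Φ t p D c mk g f else kF₁A κ Φ t p D c mk g f) du.1) + 1 < 20 * ((fcellsA κ Φ t p D g f).r du.1 : ℤ) - (b0TA κ Φ t p D g f) du.1 := by
  rw [hd]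
  simp only [if_true]
  obtain ⟨-, f2⟩ := faceL_bounds κ Φ t p D g f j hj
  have hr : ((fcellsA κ Φ t p D g f).r 0 : ℤ) = 40 * (Neg.Kq κ : ℤ) * u₀A κ Φ t p D g f := (units_eqA κ Φ t p D g f).2.2.1
  have hb : (b0TA κ Φ t p D g f 0 : ℤ) = 10 * (Neg.Kq κ : ℤ) * u₀A κ Φ t p D g f := (units_eqA κ Φ t p D g f).2.2.2.2.1
  have hq : (1 : ℤ) ≤ Neg.Kq κ := by exact_mod_cast Neg.one_le_Kq κ
  have hu : 1 ≤ u₀A κ Φ t p D g f := (units_eqA κ Φ t p D g f).2.2.2.2.2.2.1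
  have hQu : u₀A κ Φ t p D g f ≤ (Neg.Kq κ : ℤ) * u₀A κ Φ t p D g f := le_mul_of_one_le_left (by linarith) hq
  rw [hb]
  linarith

end FloorsZ

end KS

end NegB

end PlanarSkeletonNeg

end Summit.CriticalPhenomena.PercolationContinuityZ3.Theorems.Transplant

end
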